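import Literature.MathematicalPhysics.QuantumLattice.SectorPartitionFnCut
import Literature.MathematicalPhysics.QuantumLattice.FermionRelabelling
import Literature.Barriers.AtomisticToContinuum.HalfFillingGaussianDomination
import HarnessLib

/-!
# Canonical (spin-sector) partition functions are invariant under site relabellings

Family `hubbard` (topic `MathematicalPhysics/QuantumLattice`; companion of `SectorPartitionFnCut`
(`spinConfig`, `spinSectorHamiltonian`: the compression of a lattice-fermion matrix to the spin sector
`(N↑, N↓) = (a, b)`) and of `FermionRelabelling` (`relabel e`: the second quantisation `Γ a Γ⁻¹` of an
orbital bijection, with `partitionFn_relabel` for the FULL Fock-space partition function)). The full trace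
is not what the canonical certificates bind: they bind the sector-restricted traces
`Z_β(A; a, b) = tr_{(a,b)} e^{-βA} = Z_β(spinSectorHamiltonian a b A)`. This file proves their
invariance under SITE bijections `f : Λ ≃ Λ'` (orbital bijection `Orb.mapEquiv f : (x, σ) ↦ (f x, σ)`):

* `spinConfig_finsetCongr_mapEquiv_iff` — `Γ_f` maps the sector `(a, b)` of `Λ` onto the sector
  `(a, b)` of `Λ'` (it preserves the numbers of up and of down electrons);
* `spinSectorHamiltonian_relabel_mapEquiv` — the compression of `Γ_f A Γ_f⁻¹` to the sector is the
  compression of `A` conjugated by the diagonal SIGN matrix `diag(ε_f(s))` and reindexed along the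
  induced bijection of sector configurations;
* `partitionFn_spinSectorHamiltonian_relabel_mapEquiv` — hence
  `Z_β(Γ_f A Γ_f⁻¹; a, b) = Z_β(A; a, b)` (reindexing and unitary conjugation leave `tr e^{-β·}`
  invariant), and for the two-graph Hubbard Hamiltonians under a graph isomorphism
  (`partitionFn_spinSector_hamiltonian₂_eq_of_iso`, with `relabel_hamiltonian`):
  `Z_β(H_{G₁,G₁'}; a, b) = Z_β(H_{G₂,G₂'}; a, b)` whenever `f` carries `G₁, G₁'` onto `G₂, G₂'`
  — used for the coordinate swap in the strips-then-blocks iteration of the finite-temperature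
  cluster variational principle and for the identification of the square torus `(ℤ/Lℤ)²` with the
  rectangular torus `L × L`.

Everything is PROVED; no definition, no named fact.

## References

* O. Bratteli, D. W. Robinson, *Operator Algebras and Quantum Statistical Mechanics II* (1997), §5.2.2,
  Thm. 5.2.5 (one-particle bijections are unitarily implemented on Fock space).
  [cite: BratteliRobinsonII1997, §5.2.2, Thm. 5.2.5]
* E. H. Lieb, Phys. Rev. Lett. 62 (1989) 1201, proof of Theorem 1 (the `(N↑, N↓)` sectors).
  [cite: LiebPRL1989, proof of Theorem 1]

## Mathlib / tree search

REUSED: `relabel`, `relabel_apply_finsetCongr`, `relabelSign`, `relabelSign_mul_self`, `star_relabelSign`,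
`Orb.mapEquiv(_orb)`, `relabel_hamiltonian` (`FermionRelabelling`); `mem_upPart/mem_downPart`
(`HubbardLiebConfig`); `Matrix.partitionFn_unitary_conj` (`DuhamelTwoPoint`); `Matrix.partitionFn_submatrix_equiv`
(`HalfFillingGaussianDomination`). The Summits-side `upPart_finsetCongr_mapEquiv`
(`CooperPairDMottWalkPlaquetteModel`) is not importable into Literature; its 3-line proof is redone here.
-/

noncomputable section

namespace Literature.MathematicalPhysics.QuantumLattice

open Matrix Finset HubbardWave0 ThermodynamicLimit LiebThm1
open scoped ComplexOrder BigOperators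

/-! ### Reindexing and sign conjugation leave partition functions invariant -/

section MatrixTransport

variable {m : Type*} [Fintype m] [DecidableEq m]

/-- Conjugation by a diagonal matrix of self-adjoint involutive signs (`star dᵢ = dᵢ`, `dᵢ² = 1`) leaves
the partition function invariant (a diagonal unitary). [cite: BratteliRobinsonII1997, §5.2.2, Thm. 5.2.5] -/
theorem partitionFn_diagonal_conj (β : ℝ) (A : Matrix m m ℂ) {d : m → ℂ} (hd1 : ∀ i, d i * d i = 1)
    (hd2 : ∀ i, star (d i) = d i) :
    partitionFn β (diagonal d * A * diagonal d) = partitionFn β A := by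
  have hstar : star (diagonal d) = diagonal d := by
    rw [star_eq_conjTranspose, diagonal_conjTranspose]
    congr 1
    funext i
    exact hd2 i
  have hU : diagonal d ∈ unitary (Matrix m m ℂ) := by
    rw [Unitary.mem_iff, hstar, diagonal_mul_diagonal, ← diagonal_one]
    exact ⟨by congr 1; funext i; exact hd1 i, by congr 1; funext i; exact hd1 i⟩
  have h := partitionFn_unitary_conj hU β A
  rwa [hstar] at h

end MatrixTransport

/-! ### Site bijections preserve the spin sectors -/

section Sectors

variable {Λ Λ' : Type*} [LinearOrder Λ] [Fintype Λ] [LinearOrder Λ'] [Fintype Λ'] (f : Λ ≃ Λ')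

omit [LinearOrder Λ] [Fintype Λ] [LinearOrder Λ'] [Fintype Λ'] in
/-- `(Orb.mapEquiv f)⁻¹ (x', σ) = (f⁻¹ x', σ)`. [folklore] -/
private theorem mapEquiv_symm_orb (x' : Λ') (σ : Fin 2) :
    (Orb.mapEquiv f).symm (orb x' σ) = orb (f.symm x') σ :=
  (Orb.mapEquiv f).injective (by simp)

/-- Up-spin sites of a relabelled configuration: `upPart (Γ_f s) = f(upPart s)`.
[cite: LiebPRL1989, proof of Theorem 1] -/
theorem upPart_finsetCongr_mapEquiv (s : Finset (Orb Λ)) :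
    upPart ((Orb.mapEquiv f).finsetCongr s) = (upPart s).map f.toEmbedding := by
  ext x'
  rw [mem_upPart, Equiv.finsetCongr_apply, Finset.mem_map_equiv, Finset.mem_map_equiv, mem_upPart,
    mapEquiv_symm_orb]

/-- Down-spin sites of a relabelled configuration: `downPart (Γ_f s) = f(downPart s)`.
[cite: LiebPRL1989, proof of Theorem 1] -/
theorem downPart_finsetCongr_mapEquiv (s : Finset (Orb Λ)) :
    downPart ((Orb.mapEquiv f).finsetCongr s) = (downPart s).map f.toEmbedding := by
  ext x'
  rw [mem_downPart, Equiv.finsetCongr_apply, Finset.mem_map_equiv, Finset.mem_map_equiv,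
    mem_downPart, mapEquiv_symm_orb]

/-- **A site bijection maps the spin sector `(a, b)` onto the spin sector `(a, b)`.**
[cite: LiebPRL1989, proof of Theorem 1] -/
theorem spinConfig_finsetCongr_mapEquiv_iff (a b : ℕ) (s : Finset (Orb Λ)) :
    spinConfig a b ((Orb.mapEquiv f).finsetCongr s) ↔ spinConfig a b s := by
  simp only [spinConfig, upPart_finsetCongr_mapEquiv, downPart_finsetCongr_mapEquiv, Finset.card_map]

/-- The induced bijection between the sector configurations of `Λ` and of `Λ'`.
[cite: LiebPRL1989, proof of Theorem 1] -/
def spinConfigEquiv (a b : ℕ) : Subtype (spinConfig (Λ := Λ) a b) ≃ Subtype (spinConfig (Λ := Λ') a b) :=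
  (Orb.mapEquiv f).finsetCongr.subtypeEquiv fun s => (spinConfig_finsetCongr_mapEquiv_iff f a b s).symm

/-- Unfolding: the underlying configuration of the image is `Γ_f s`.
[cite: LiebPRL1989, proof of Theorem 1] -/
@[simp] theorem coe_spinConfigEquiv (a b : ℕ) (c : Subtype (spinConfig (Λ := Λ) a b)) :
    ((spinConfigEquiv f a b c) : Finset (Orb Λ')) = (Orb.mapEquiv f).finsetCongr c.1 := rfl

end Sectors

/-! ### The sector compression of a relabelled matrix; invariance of canonical partition functions -/

section Transport

variable {Λ Λ' : Type*} [LinearOrder Λ] [Fintype Λ] [LinearOrder Λ'] [Fintype Λ'] (f : Λ ≃ Λ')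

/-- **The compression of `Γ_f A Γ_f⁻¹` to a spin sector** is the compression of `A`, conjugated by the
diagonal sign matrix `diag(ε_f(s))` and reindexed along `spinConfigEquiv`:
`(Γ A Γ⁻¹)|_{(a,b)} = (D · A|_{(a,b)} · D).submatrix σ⁻¹ σ⁻¹`. [cite: BratteliRobinsonII1997, §5.2.2, Thm. 5.2.5] -/
theorem spinSectorHamiltonian_relabel_mapEquiv (a b : ℕ) (A : Matrix (Finset (Orb Λ)) (Finset (Orb Λ)) ℂ) :
    spinSectorHamiltonian a b (relabel (Orb.mapEquiv f) A) =
      (diagonal (fun c : Subtype (spinConfig (Λ := Λ) a b) => relabelSign (Orb.mapEquiv f) c.1) *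
          spinSectorHamiltonian a b A *
          diagonal (fun c : Subtype (spinConfig (Λ := Λ) a b) => relabelSign (Orb.mapEquiv f) c.1)).submatrix
        (spinConfigEquiv f a b).symm (spinConfigEquiv f a b).symm := by
  ext c' d'
  obtain ⟨c, rfl⟩ := (spinConfigEquiv f a b).surjective c'
  obtain ⟨d, rfl⟩ := (spinConfigEquiv f a b).surjective d'
  rw [submatrix_apply, Equiv.symm_apply_apply, Equiv.symm_apply_apply, mul_diagonal, diagonal_mul,
    spinSectorHamiltonian, submatrix_apply, spinSectorHamiltonian, submatrix_apply,
    coe_spinConfigEquiv, coe_spinConfigEquiv, relabel_apply_finsetCongr]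

/-- **Canonical partition functions are invariant under site relabellings**:
`Z_β(Γ_f A Γ_f⁻¹; a, b) = Z_β(A; a, b)`. [cite: BratteliRobinsonII1997, §5.2.2, Thm. 5.2.5] -/
theorem partitionFn_spinSectorHamiltonian_relabel_mapEquiv (β : ℝ) (a b : ℕ)
    (A : Matrix (Finset (Orb Λ)) (Finset (Orb Λ)) ℂ) :
    partitionFn β (spinSectorHamiltonian a b (relabel (Orb.mapEquiv f) A)) =
      partitionFn β (spinSectorHamiltonian a b A) := by
  rw [spinSectorHamiltonian_relabel_mapEquiv, partitionFn_submatrix_equiv,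
    partitionFn_diagonal_conj β _ (fun c => relabelSign_mul_self _ _) (fun c => star_relabelSign _ _)]

/-- **Canonical partition functions of two-graph Hubbard Hamiltonians under a graph isomorphism**:
if the site bijection `f : Λ ≃ Λ'` carries the bond sets `G, G'` of `Λ` onto `K, K'` of `Λ'`, then
`Z_β(H_{K,K'}(t,U,t',U'); a, b) = Z_β(H_{G,G'}(t,U,t',U'); a, b)` for every sector `(a, b)`
(`relabel_hamiltonian` and the preceding invariance). [cite: BratteliRobinsonII1997, §5.2.2, Thm. 5.2.5] -/
theorem partitionFn_spinSector_hamiltonian₂_eq_of_iso (G G' : SimpleGraph Λ) (K K' : SimpleGraph Λ')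
    [DecidableRel G.Adj] [DecidableRel G'.Adj] [DecidableRel K.Adj] [DecidableRel K'.Adj]
    (hG : ∀ x y, K.Adj (f x) (f y) ↔ G.Adj x y) (hG' : ∀ x y, K'.Adj (f x) (f y) ↔ G'.Adj x y)
    (t U t' U' β : ℝ) (a b : ℕ) :
    partitionFn β (spinSectorHamiltonian a b (hamiltonian K t U + hamiltonian K' t' U')) =
      partitionFn β (spinSectorHamiltonian a b (hamiltonian G t U + hamiltonian G' t' U')) := by
  rw [← partitionFn_spinSectorHamiltonian_relabel_mapEquiv f β a b
      (hamiltonian G t U + hamiltonian G' t' U'),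
    map_add, relabel_hamiltonian G K f hG, relabel_hamiltonian G' K' f hG']

end Transport

end Literature.MathematicalPhysics.QuantumLattice
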